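import Summits.BirchSwinnertonDyer.BirchSwinnertonDyer.Theorems.PrintCFramBottomClassIndexLawFiveLeFlipRungOfRung
import HarnessLib

/-!
# Crux `PrintCFram.BottomClassIndexLawFiveLe` (stmt-BirchSwinnertonDyer-20372), line `eisenstein-resource-bdp-line` (registry v28 → v30):
# (FlipRungAll⁶) ⟸ (RungAll⁶) — the flipped rung at EVERY odd prime `q ∣ m` in Bernoulli currency from the rung in Cohen-number currency
# (cell `bsd-print-cfram`, width seat `bsd-line-cfram-p1-w2` g15; THEOREMS ONLY, `--supports` 20372; BSD is not proved by any of this)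

HONEST FRAMING. Nothing here is a statement about BSD; no registered stub is closed by this file alone. This is w8 g9's layer A
`FlipRung.flipRung_six_of_rung` (p707470) VERBATIM with the flippability hypothesis `¬ ((p : ℤ) ∣ (q : ℤ) * jacobiSym (-1) q - 1) →`
DELETED on both sides:

* **(RungAll⁶)** := (Rung⁶) without that line — «`‖H(k, a)‖_p ≤ p⁻¹` on the `τ`-cut ⟹ on the cut flipped at `q`» for every class datum of
  the six leaf primes, every `±1`-pattern `τ` and EVERY odd prime `q ∣ m` (supplied from Raum 2023 Prop. 2.3 by the companion file
  `…FlipRungRaumCoupling.rungAll_six_of_raum`, or from NF-A ∧ NF-Q by the typing item T8 «the lower-unipotent rung»);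
* **(FlipRungAll⁶)** := (FlipRung⁶) (the `hFlip` binder of `FlipRung.seedOffExc_of_flipRung_of_bad`, p706253) without that line.

The proof is w8 g9's: the Cohen dictionary on the cut (`H(k, m n₀ f²) = −T·k⁻¹B_k((χ↑ε_K↑)~)`, `T ∈ ℤ`, `T = 1` at `f = 1`) turns the
Bernoulli hypothesis into the Cohen-number hypothesis on the `τ`-cut, (RungAll⁶) flips, and at the fundamental index `a = m·|d_{K₀}|` of
the flipped cut the field factor IS `−H(k, a)`. With it LEAD g14's §3 induction runs over ALL of `Q_off` (no bad prime), so together with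
w7 g8's 2-adic rung the line's analytic side has no research residue. beyond-print theorem: NO (dictionary / plumbing).
References: [Cohen1975] §2, Thm. 3.1; [Washington1997] Thm. 4.2; crux notes `Lines/eisenstein-resource-bdp-line-lead-g14.md` §2,
`…-w2g15-notes.md`; HOME/STATUS 08:41Z–08:53Z (2026-08-29).
-/

set_option autoImplicit false
-- summit-side namespace `Summit.BirchSwinnertonDyer.BirchSwinnertonDyer.…` (single-conjunct summit, D-0017 layout)
set_option linter.dupNamespace false

noncomputable section

open scoped Classical NumberTheorySymbols
open NumberField DirichletCharacter Literature.NumberTheory.LFunctions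
  Literature.NumberTheory.ModularForms.CohenEisenstein
  Literature.NumberTheory.EllipticCurves Literature.NumberTheory.EllipticCurves.KrizLi2019
  Literature.NumberTheory.QuadraticFields

namespace Summit.BirchSwinnertonDyer.BirchSwinnertonDyer.Theorems.PrintCFram.FlipRung

open Summit.BirchSwinnertonDyer.BirchSwinnertonDyer.Theorems.PrintCFram

/-! ## (FlipRungAll⁶) ⟸ (RungAll⁶) -/

/-- **THE FLIPPED RUNG IN BERNOULLI CURRENCY AT EVERY ODD PRIME FROM (RungAll⁶)** — w8 g9's `flipRung_six_of_rung` (p707470) VERBATIM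
with the flippability hypothesis `¬ (p ∣ q·J(−1|q) − 1)` deleted on both sides: the dictionary `H(k, m n₀ f²) = −T·k⁻¹B_k((χ↑ε_K↑)~)`
(`T ∈ ℤ`, `T = 1` at `f = 1`) turns the Bernoulli hypothesis into the Cohen-number hypothesis on the `τ`-cut, (RungAll⁶) flips, and
at the fundamental index `a = m·|d_{K₀}|` of the flipped cut the field factor IS `−H(k, a)`. Conclusion (FlipRungAll⁶) = the `hFlip`
binder of `FlipRung.seedOffExc_of_flipRung_of_bad` without its `hstar` line. [cite: Cohen1975, §2 (definition of H(r, N)) and Thm. 3.1]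
[cite: Washington1997, Thm. 4.2] -/
theorem flipRungAll_six_of_rungAll
    (hRung : ∀ (p : ℕ) [Fact p.Prime] (m : ℕ) [NeZero m] (χ : DirichletCharacter ℚ_[p] m) (k : ℕ),
      (p = 7 ∨ p = 11 ∨ p = 19 ∨ p = 43 ∨ p = 67 ∨ p = 163) →
      m.Coprime p → χ.IsPrimitive → χ.IsQuadratic → (k = (p + 1) / 4 ∨ k = (3 * p - 1) / 4) →
      2 ≤ k → k ≤ p - 2 → χ (-1) * (-1) ^ k = -1 →
      ∀ (τ : ℕ → ℤ) (q : ℕ), q.Prime → q ∣ m → q ≠ 2 →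
      (∀ q' : ℕ, q'.Prime → q' ∣ m → q' ≠ 2 → (τ q' = 1 ∨ τ q' = -1)) →
      (∀ a : ℕ, m ∣ a → a / m % 4 = 3 →
        (∀ q' : ℕ, q'.Prime → q' ∣ m → q' ≠ 2 → jacobiSym (-((a / m : ℕ) : ℤ)) q' = τ q') →
        (2 ∣ m → a / m % 8 = 7) → ¬ 3 ∣ a / m → ‖((cohenH k a : ℚ) : ℚ_[p])‖ ≤ (p : ℝ)⁻¹) →
      ∀ a : ℕ, m ∣ a → a / m % 4 = 3 →
        (∀ q' : ℕ, q'.Prime → q' ∣ m → q' ≠ 2 → jacobiSym (-((a / m : ℕ) : ℤ)) q' = (if q' = q then -τ q' else τ q')) →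
        (2 ∣ m → a / m % 8 = 7) → ¬ 3 ∣ a / m → ‖((cohenH k a : ℚ) : ℚ_[p])‖ ≤ (p : ℝ)⁻¹) :
    ∀ (p : ℕ) [Fact p.Prime] (m : ℕ) [NeZero m] (χ : DirichletCharacter ℚ_[p] m) (k : ℕ),
      (p = 7 ∨ p = 11 ∨ p = 19 ∨ p = 43 ∨ p = 67 ∨ p = 163) →
      m.Coprime p → χ.IsPrimitive → χ.IsQuadratic → (k = (p + 1) / 4 ∨ k = (3 * p - 1) / 4) →
      2 ≤ k → k ≤ p - 2 → χ (-1) * (-1) ^ k = -1 →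
      ∀ (τ : ℕ → ℤ) (q : ℕ), q.Prime → q ∣ m → q ≠ 2 →
      (∀ q' : ℕ, q'.Prime → q' ∣ m → q' ≠ 2 → (τ q' = 1 ∨ τ q' = -1)) →
      (∀ (K₀ : Type) [Field K₀] [NumberField K₀] (ε₀ : DirichletCharacter ℚ_[p] (NumberField.discr K₀).natAbs),
        IsImaginaryQuadratic K₀ → Odd (NumberField.discr K₀) → NumberField.discr K₀ < -4 →
        ¬ ((3 : ℤ) ∣ NumberField.discr K₀) →
        (∀ q' : ℕ, q'.Prime → q' ∣ m → q' ≠ 2 → jacobiSym (NumberField.discr K₀) q' = τ q') →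
        (2 ∣ m → NumberField.discr K₀ % 8 = 1) → IsKroneckerCharacterOf K₀ ε₀ →
        ‖(k : ℚ_[p])⁻¹ * @generalizedBernoulli ℚ_[p] _ _
            (changeLevel (dvd_mul_right m (NumberField.discr K₀).natAbs) χ *
              changeLevel (dvd_mul_left (NumberField.discr K₀).natAbs m) ε₀).conductor ⟨conductor_ne_zero _⟩ k
            (changeLevel (dvd_mul_right m (NumberField.discr K₀).natAbs) χ *
              changeLevel (dvd_mul_left (NumberField.discr K₀).natAbs m) ε₀).primitiveCharacter‖ ≤ (p : ℝ)⁻¹) →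
      ∀ (K₀ : Type) [Field K₀] [NumberField K₀] (ε₀ : DirichletCharacter ℚ_[p] (NumberField.discr K₀).natAbs),
        IsImaginaryQuadratic K₀ → Odd (NumberField.discr K₀) → NumberField.discr K₀ < -4 →
        ¬ ((3 : ℤ) ∣ NumberField.discr K₀) →
        (∀ q' : ℕ, q'.Prime → q' ∣ m → q' ≠ 2 → jacobiSym (NumberField.discr K₀) q' = (if q' = q then -τ q' else τ q')) →
        (2 ∣ m → NumberField.discr K₀ % 8 = 1) → IsKroneckerCharacterOf K₀ ε₀ →
        ‖(k : ℚ_[p])⁻¹ * @generalizedBernoulli ℚ_[p] _ _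
            (changeLevel (dvd_mul_right m (NumberField.discr K₀).natAbs) χ *
              changeLevel (dvd_mul_left (NumberField.discr K₀).natAbs m) ε₀).conductor ⟨conductor_ne_zero _⟩ k
            (changeLevel (dvd_mul_right m (NumberField.discr K₀).natAbs) χ *
              changeLevel (dvd_mul_left (NumberField.discr K₀).natAbs m) ε₀).primitiveCharacter‖ ≤ (p : ℝ)⁻¹ := by
  intro p _ m _ χ k hp6 hmp hχ hχq hk hk2 hkp hpar τ q hq hqm hq2 hτ hHyp K₀ _ _ ε₀ hK hodd hlt h3 hpat h8 hε
  have hm0 : 0 < m := Nat.pos_of_ne_zero (NeZero.ne m)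
  -- the flipped pattern is `±1`-valued
  have hτ' : ∀ q' : ℕ, q'.Prime → q' ∣ m → q' ≠ 2 →
      ((fun x : ℕ => if x = q then -τ x else τ x) q' = 1 ∨ (fun x : ℕ => if x = q then -τ x else τ x) q' = -1) := by
    intro q' hq' hq'm hq'2
    rcases hτ q' hq' hq'm hq'2 with h | h
    · by_cases hqq : q' = q
      · subst hqq; simp [h]
      · simp [hqq, h]
    · by_cases hqq : q' = q
      · subst hqq; simp [h]
      · simp [hqq, h]
  -- Step 1: the hypothesis of the rung on the `τ`-cut, from the Bernoulli hypothesis through the dictionary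
  have hcut : ∀ a : ℕ, m ∣ a → a / m % 4 = 3 →
      (∀ q' : ℕ, q'.Prime → q' ∣ m → q' ≠ 2 → jacobiSym (-((a / m : ℕ) : ℤ)) q' = τ q') →
      (2 ∣ m → a / m % 8 = 7) → ¬ 3 ∣ a / m → ‖((cohenH k a : ℚ) : ℚ_[p])‖ ≤ (p : ℝ)⁻¹ := by
    intro a hma ha4 hJ h8a h3a
    obtain ⟨n₀, f, hsq, hn4, hf, rfl, hdiv⟩ := CohenCut.exists_eq_mul_sq_of_cut hma ha4
    rw [hdiv] at hJ h8a h3a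
    obtain ⟨-, -, hn8⟩ := ThetaCycle.mod_four_of_sq_mul (f := f) (n₁ := n₀) (by rw [mul_comm, ← hdiv]; exact ha4)
    have hn3 : ¬ 3 ∣ n₀ := fun h => h3a (dvd_mul_of_dvd_left h _)
    have hn7 : 4 < n₀ := by
      have : n₀ ≠ 3 := fun h => hn3 (h ▸ dvd_rfl)
      omega
    -- the field `K = ℚ(√−n₀)` and its Kronecker character
    have hsqZ : Squarefree (-(n₀ : ℤ)) := by
      rw [← Int.squarefree_natAbs, Int.natAbs_neg, Int.natAbs_natCast]; exact hsq
    obtain ⟨K, iF, iN, h2, hd⟩ := Quadratic.exists_numberField_discr_eq (D := -(n₀ : ℤ))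
      (Or.inl ⟨by omega, hsqZ, by omega⟩)
    have hKim : IsImaginaryQuadratic K := isImaginaryQuadratic_of_discr_eq_of_neg h2 hd (by omega)
    obtain ⟨εK, hεK, -⟩ :=
      KrizLiBinders.exists_isKroneckerCharacterOf_of_discr (p := p) h2 (m := n₀) hsq (Or.inr ⟨hd, hn4⟩)
    -- the Bernoulli hypothesis at `(K, ε_K)`
    have hB := hHyp K εK hKim (by rw [hd, Int.odd_iff]; omega) (by rw [hd]; omega)
      (by rw [hd, Int.dvd_neg]; exact_mod_cast hn3)
      (fun q' hq' hq'm hq'2 => by rw [hd]; exact jacobiSym_neg_eq_of_neg_mul_sq (hτ q' hq' hq'm hq'2) (hJ q' hq' hq'm hq'2))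
      (fun h2m => by rw [hd]; have := hn8 (by rw [mul_comm]; exact h8a h2m); omega) hεK
    -- the dictionary
    exact norm_ratCast_cohenH_cut_le_of_norm_bernoulli_le hχ hχq hpar hsq hn4 hf (coprime_of_cut_sign hn4 hτ hJ) hKim hd hεK hB
  -- Step 2: the rung, then read its conclusion at the fundamental index `a = m·|d_K₀|`
  have hflip := hRung p m χ k hp6 hmp hχ hχq hk hk2 hkp hpar τ q hq hqm hq2 hτ hcut
  -- `d_K₀ = −n₀`, `n₀ ≡ 3 (4)` squarefree, prime to `3`
  rcases Quadratic.isFundamentalDiscriminant_discr (K := K₀) hK.1 with ⟨hd4, hsqd, -⟩ | ⟨hd4, -, -⟩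
  swap
  · exfalso
    rw [Int.odd_iff] at hodd
    omega
  obtain ⟨n₀, hn₀⟩ : ∃ n₀ : ℕ, NumberField.discr K₀ = -(n₀ : ℤ) :=
    ⟨(NumberField.discr K₀).natAbs, by rw [Int.ofNat_natAbs_of_nonpos (by omega)]; ring⟩
  have hn4 : n₀ % 4 = 3 := by omega
  have hsq : Squarefree n₀ := by
    have h := Int.squarefree_natAbs.mpr hsqd
    rwa [hn₀, Int.natAbs_neg, Int.natAbs_natCast] at h
  have hn3 : ¬ 3 ∣ n₀ := fun h => h3 (by rw [hn₀, Int.dvd_neg]; exact_mod_cast h)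
  have hdiv : m * (n₀ * 1 ^ 2) / m = n₀ := by rw [one_pow, mul_one, Nat.mul_div_cancel_left _ hm0]
  have hJ' : ∀ q' : ℕ, q'.Prime → q' ∣ m → q' ≠ 2 →
      jacobiSym (-((n₀ * 1 ^ 2 : ℕ) : ℤ)) q' = (fun x : ℕ => if x = q then -τ x else τ x) q' := by
    intro q' hq' hq'm hq'2
    rw [show (-((n₀ * 1 ^ 2 : ℕ) : ℤ)) = NumberField.discr K₀ by rw [hn₀]; push_cast; ring]
    exact hpat q' hq' hq'm hq'2
  have hHa := hflip (m * (n₀ * 1 ^ 2)) (dvd_mul_right _ _) (by rw [hdiv]; exact hn4)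
    (fun q' hq' hq'm hq'2 => by
      rw [hdiv, ← hn₀]
      exact hpat q' hq' hq'm hq'2)
    (fun h2m => by rw [hdiv]; have := h8 h2m; omega) (by rw [hdiv]; exact hn3)
  have hcop : m.Coprime n₀ := coprime_of_cut_sign (f := 1) hn4 hτ' hJ'
  rw [norm_bernoulli_eq_norm_ratCast_cohenH hχ hχq hpar hsq hn4 hcop hK hn₀ hε]
  simpa using hHa

end Summit.BirchSwinnertonDyer.BirchSwinnertonDyer.Theorems.PrintCFram.FlipRung

end
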